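import Literature.AnabelianGeometry.SemiGraphs.PSCSeparatingCoveringsIrreducibleMultiNodalEdges
import Literature.GroupTheory.CombinatorialGroupTheory.PuncturedSurfaceGroupTwoNodeCycleBases
import HarnessLib

/-!
# [CombGC] Prop. 1.2, proof p. 9: verticial separating coverings and verticial commensurable terminality at the two-component curve with TWO nodes

Mochizuki, *A combinatorial version of the Grothendieck conjecture*, Tohoku Math. J. **59** (2007)
[CombGC], PROOF of Proposition 1.2, p. 9 (separating coverings, verticial case; typed LEVEL-WISE as
`PSCDatum.VerticialSeparatingCoverings`, row P12-L01-V, instance form of FACT-LIST row F-2826) and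
Prop. 1.2 (ii) p. 8 for VERTICIAL subgroups [cite: MochizukiCombGC2007, Prop 1.2 proof p.9]
[cite: MochizukiCombGC2007, Prop 1.2(ii) p.8].

PROOF-ONLY file (abc-iut-f-164 gen 5; WAKE row «TWO-NODE-CYCLE» of the lineage): the FIRST dual graph
with a CYCLE between two components — `C₀` (handles `i < m`, cusps `j ≥ s`) and `C₁` (handles `i > m`,
cusps `j < s`) joined at TWO nodes, first Betti number `1`, arithmetic genus `g = m + (g − m − 1) + 1`;
over a pro-`Σ` completion `ι : Γ_{g,r'+1} → Π` of the smoothing the vanishing cycles are `b_m` and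
`δ = (c_0⋯c_{s−1})⁻¹(∏_{i>m}[a_i,b_i])⁻¹ b_m`, the vertex groups
`Π_{v₀} = cl ι⟨a_i,b_i (i<m), c_j (j≥s), a_m b_m a_m⁻¹, δ⟩`, `Π_{v₁} = cl ι⟨a_i,b_i (i>m), c_j (j<s), b_m, δ⟩`
— closures of FREE FACTORS (`PuncturedSurfaceGroupTwoNodeCycleBases.lean`: the `c₀`-eliminating basis
with `b_m ↦ a_m b_m a_m⁻¹`, resp. the `c_{r'}`-eliminating basis).  Same-vertex pairs: abc-iut-f-166's
fibred twist (`freeFactor_exists_open_separating_sameVertex`); cross-vertex pairs: the indicator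
characters of `a_0` (kills `Π_{v₁}`) and `a_{m+1}` (kills `Π_{v₀}`) (`exists_open_separating_of_character`).
HONEST SCOPE: both components of POSITIVE genus (`1 ≤ m`, `m + 2 ≤ g`) and both marked (`1 ≤ s ≤ r'`);
genus-`0` components need cusp-balanced characters (not done here).

* `verticialSeparatingCoverings_of_twoNodeCycle` — **F-2826 / P12-L01-V (`V' := V`)**;
* `verticialRows_of_twoNodeCycle` — with Prop. 1.2 (i) verticial and Prop. 1.2 (ii) for verticial
  subgroups (w5-d183's reductions).

Instance forms at data of the shape of genuine curves; 0 definitions; nothing here takes a side on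
[IUTchIII] Cor. 3.12.
-/

noncomputable section

namespace Literature.AnabelianGeometry.SemiGraphs

open scoped Pointwise
open Literature.GroupTheory.CombinatorialGroupTheory
open Literature.GroupTheory.CombinatorialGroupTheory.PuncturedSurfaceGroup
open Literature.GroupTheory.CombinatorialGroupTheory.FreeFactorFibredTwist (lift_apply_basis)
open Literature.GroupTheory.CombinatorialGroupTheory.FreeBasisCutoffCharacterTwist (map_eq_one_of_mem_closure)
open SemiGraphOfAnabelioids (IsProSigmaCompletion)
open SemiGraphOfAnabelioids.IsProSigmaCompletion (freeFactor_exists_open_separating_sameVertex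
  exists_open_separating_of_character)

namespace PSCDatum

section Datum

variable {P : Type} [Group P] [TopologicalSpace P] [IsTopologicalGroup P]
variable [CompactSpace P] [TotallyDisconnectedSpace P] {Sigma : Set ℕ} {g r : ℕ}

/-- **F-2826 / row P12-L01-V (`VerticialSeparatingCoverings`, `V' := V`) at EVERY two-component datum with
TWO nodes** (2-cycle dual graph; both components of positive genus and marked).
[cite: MochizukiCombGC2007, Prop 1.2 proof p.9] -/
theorem verticialSeparatingCoverings_of_twoNodeCycle (hne : Sigma.Nonempty)
    (hprime : ∀ p ∈ Sigma, p.Prime) (ι : PuncturedSurfaceGroup g r →* P)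
    (hι : IsProSigmaCompletion Sigma ι) (G : PSCDatum P) {m s : ℕ} (hm : m + 2 ≤ g) (hm1 : 1 ≤ m)
    (hs1 : 1 ≤ s) (hsr : s + 1 ≤ r)
    (v₀ v₁ : G.graph.V) (hV : ∀ w, w = v₀ ∨ w = v₁) (δ : PuncturedSurfaceGroup g r)
    (hδ : δ = (((List.finRange r).map fun j : Fin r =>
        if (j : ℕ) < s then PuncturedSurfaceGroup.c (g := g) j else 1).prod)⁻¹ *
      (((List.finRange g).map fun i : Fin g => if m + 1 ≤ (i : ℕ) then
        PuncturedSurfaceGroup.a (r := r) i * PuncturedSurfaceGroup.b i *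
          (PuncturedSurfaceGroup.a i)⁻¹ * (PuncturedSurfaceGroup.b i)⁻¹ else 1).prod)⁻¹ *
      PuncturedSurfaceGroup.b ⟨m, by omega⟩)
    (hV₀ : G.vertGp v₀ = ((Subgroup.closure {x : PuncturedSurfaceGroup g r |
        (∃ i : Fin g, (i : ℕ) < m ∧ (x = PuncturedSurfaceGroup.a i ∨ x = PuncturedSurfaceGroup.b i)) ∨
        (∃ j : Fin r, s ≤ (j : ℕ) ∧ x = PuncturedSurfaceGroup.c j) ∨
        x = PuncturedSurfaceGroup.a ⟨m, by omega⟩ * PuncturedSurfaceGroup.b ⟨m, by omega⟩ *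
          (PuncturedSurfaceGroup.a ⟨m, by omega⟩)⁻¹ ∨ x = δ}).map ι).topologicalClosure)
    (hV₁ : G.vertGp v₁ = ((Subgroup.closure {x : PuncturedSurfaceGroup g r |
        (∃ i : Fin g, m < (i : ℕ) ∧ (x = PuncturedSurfaceGroup.a i ∨ x = PuncturedSurfaceGroup.b i)) ∨
        (∃ j : Fin r, (j : ℕ) < s ∧ x = PuncturedSurfaceGroup.c j) ∨
        x = PuncturedSurfaceGroup.b ⟨m, by omega⟩ ∨ x = δ}).map ι).topologicalClosure) :
    G.VerticialSeparatingCoverings := by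
  classical
  obtain ⟨r', rfl⟩ : ∃ r', r = r' + 1 := ⟨r - 1, by omega⟩
  have hmg : m < g := by omega
  have hsr' : s ≤ r' := by omega
  obtain ⟨ℓ, hℓS⟩ := hne
  have hℓ : ℓ.Prime := hprime ℓ hℓS
  -- the three bases
  obtain ⟨b₀, ha₀, hb₀, hc₀⟩ := exists_freeGroupBasis_elim_zero g r'
  obtain ⟨bA, haA, hbA, hkA, hcA⟩ := exists_freeGroupBasis_cycleFirst g r' m hmg
  obtain ⟨bl, hal, hbl, hcl⟩ := exists_freeGroupBasis_elim_last g r'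
  set S_A : Set ((Fin g × Bool) ⊕ Fin r') := {y | Sum.elim (fun p : Fin g × Bool =>
    (p.1 : ℕ) < m ∨ (p.1 = ⟨m, hmg⟩ ∧ p.2 = true)) (fun j : Fin r' => s ≤ (j : ℕ) + 1) y} with hS_A
  set S_B : Set ((Fin g × Bool) ⊕ Fin r') := {y | Sum.elim (fun p : Fin g × Bool =>
    m < (p.1 : ℕ) ∨ (p.1 = ⟨m, hmg⟩ ∧ p.2 = true)) (fun j : Fin r' => (j : ℕ) < s) y} with hS_B
  have hA_eq := closure_cycleFirst_eq hmg hδ hs1 haA hbA hkA hcA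
  have hB_eq := closure_cycleSecond_eq hmg hδ hsr' hal hbl hcl
  have hV₀' : G.vertGp v₀ = ((Subgroup.closure (bA '' S_A)).map ι).topologicalClosure := by rw [hV₀, hA_eq]
  have hV₁' : G.vertGp v₁ = ((Subgroup.closure (bl '' S_B)).map ι).topologicalClosure := by rw [hV₁, hB_eq]
  have hSA_ne : S_A.Nonempty := ⟨Sum.inl (⟨m, hmg⟩, true), Or.inr ⟨rfl, rfl⟩⟩
  have hSB_ne : S_B.Nonempty := ⟨Sum.inl (⟨m, hmg⟩, true), Or.inr ⟨rfl, rfl⟩⟩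
  -- the indicator characters of `a_0` and `a_{m+1}` on the `c₀`-eliminating basis
  let i₀ : Fin g := ⟨0, by omega⟩
  let i₁ : Fin g := ⟨m + 1, by omega⟩
  let fA : (Fin g × Bool) ⊕ Fin r' → Multiplicative ℤ := fun y =>
    if y = Sum.inl (i₀, false) then Multiplicative.ofAdd 1 else 1
  let fB : (Fin g × Bool) ⊕ Fin r' → Multiplicative ℤ := fun y =>
    if y = Sum.inl (i₁, false) then Multiplicative.ofAdd 1 else 1
  have hone : (Multiplicative.ofAdd (1 : ℤ)) ≠ 1 := fun h =>
    one_ne_zero (Multiplicative.ofAdd.injective (h.trans ofAdd_zero.symm))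
  have hfA0 : fA (Sum.inl (i₀, false)) = Multiplicative.ofAdd 1 := by simp [fA]
  have hfAa : ∀ i, i ≠ i₀ → fA (Sum.inl (i, false)) = 1 := fun i hi => by simp [fA, hi]
  have hfAb : ∀ i, fA (Sum.inl (i, true)) = 1 := fun i => by simp [fA]
  have hfAc : ∀ k, fA (Sum.inr k) = 1 := fun k => by simp [fA]
  have hfB0 : fB (Sum.inl (i₁, false)) = Multiplicative.ofAdd 1 := by simp [fB]
  have hfBa : ∀ i, i ≠ i₁ → fB (Sum.inl (i, false)) = 1 := fun i hi => by simp [fB, hi]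
  have hfBb : ∀ i, fB (Sum.inl (i, true)) = 1 := fun i => by simp [fB]
  have hfBc : ∀ k, fB (Sum.inr k) = 1 := fun k => by simp [fB]
  have hΨa : ∀ (f : (Fin g × Bool) ⊕ Fin r' → Multiplicative ℤ) (i : Fin g),
      b₀.lift f (PuncturedSurfaceGroup.a i) = f (Sum.inl (i, false)) := fun f i => by rw [← ha₀, lift_apply_basis]
  have hΨb : ∀ (f : (Fin g × Bool) ⊕ Fin r' → Multiplicative ℤ) (i : Fin g),
      b₀.lift f (PuncturedSurfaceGroup.b i) = f (Sum.inl (i, true)) := fun f i => by rw [← hb₀, lift_apply_basis]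
  have hΨc : ∀ (f : (Fin g × Bool) ⊕ Fin r' → Multiplicative ℤ) (j : Fin (r' + 1)) (hj : j ≠ 0),
      b₀.lift f (c j) = f (Sum.inr (j.pred hj)) := fun f j hj => by
    conv_lhs => rw [← Fin.succ_pred j hj, ← hc₀, lift_apply_basis]
  -- every cusp is killed by both characters
  have hcuspA : ∀ j : Fin (r' + 1), b₀.lift fA (c j) = 1 := by
    intro j
    by_cases hj : j = 0
    · have e0 : j = ⟨0, Nat.succ_pos r'⟩ := by rw [hj]; rfl
      rw [e0, map_lift_c_zero ha₀ hb₀ hc₀ fA i₀ ⟨0, by omega⟩ hfAa (fun k _ => hfAc k), hfA0, hfAb, hfAc]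
      simp
    · rw [hΨc _ _ hj, hfAc]
  have hcuspB : ∀ j : Fin (r' + 1), b₀.lift fB (c j) = 1 := by
    intro j
    by_cases hj : j = 0
    · have e0 : j = ⟨0, Nat.succ_pos r'⟩ := by rw [hj]; rfl
      rw [e0, map_lift_c_zero ha₀ hb₀ hc₀ fB i₁ ⟨0, by omega⟩ hfBa (fun k _ => hfBc k), hfB0, hfBb, hfBc]
      simp
    · rw [hΨc _ _ hj, hfBc]
  have hcommA : b₀.lift fA ((List.finRange g).map fun i : Fin g => if m + 1 ≤ (i : ℕ) then
      PuncturedSurfaceGroup.a (r := r' + 1) i * PuncturedSurfaceGroup.b i *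
        (PuncturedSurfaceGroup.a i)⁻¹ * (PuncturedSurfaceGroup.b i)⁻¹ else 1).prod = 1 :=
    map_comm_prod_ite_eq_one _ _
  have hcommB : b₀.lift fB ((List.finRange g).map fun i : Fin g => if m + 1 ≤ (i : ℕ) then
      PuncturedSurfaceGroup.a (r := r' + 1) i * PuncturedSurfaceGroup.b i *
        (PuncturedSurfaceGroup.a i)⁻¹ * (PuncturedSurfaceGroup.b i)⁻¹ else 1).prod = 1 :=
    map_comm_prod_ite_eq_one _ _
  have hClA : ∀ (f : (Fin g × Bool) ⊕ Fin r' → Multiplicative ℤ), (∀ j : Fin (r' + 1), b₀.lift f (c j) = 1) →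
      b₀.lift f ((List.finRange (r' + 1)).map fun j : Fin (r' + 1) =>
        if (j : ℕ) < s then c (g := g) j else 1).prod = 1 := by
    intro f hf
    rw [map_prod_map_finRange_ite]
    exact List.prod_eq_one fun y hy => by
      obtain ⟨j, -, rfl⟩ := List.mem_map.mp hy
      by_cases hj : (j : ℕ) < s
      · rw [if_pos hj, hf]
      · rw [if_neg hj]
  have hδA : b₀.lift fA δ = 1 := by
    rw [hδ, map_mul, map_mul, map_inv, map_inv, hClA fA hcuspA, hcommA, hΨb, hfAb]
    simp
  have hδB : b₀.lift fB δ = (1 : Multiplicative ℤ) := by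
    rw [hδ, map_mul, map_mul, map_inv, map_inv, hClA fB hcuspB, hcommB, hΨb, hfBb]
    simp
  -- `Ψ_A = b₀.lift fA` kills `Π_{v₁}`'s generators; `Ψ_B` kills `Π_{v₀}`'s
  have hkillB : ∀ x ∈ Subgroup.closure {x : PuncturedSurfaceGroup g (r' + 1) |
        (∃ i : Fin g, m < (i : ℕ) ∧ (x = PuncturedSurfaceGroup.a i ∨ x = PuncturedSurfaceGroup.b i)) ∨
        (∃ j : Fin (r' + 1), (j : ℕ) < s ∧ x = PuncturedSurfaceGroup.c j) ∨
        x = PuncturedSurfaceGroup.b ⟨m, hmg⟩ ∨ x = δ}, b₀.lift fA x = 1 := by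
    intro x hx
    rw [← MonoidHom.mem_ker]
    refine (Subgroup.closure_le _).mpr ?_ hx
    rintro y (⟨i, hi, rfl | rfl⟩ | ⟨j, -, rfl⟩ | rfl | rfl) <;> rw [SetLike.mem_coe, MonoidHom.mem_ker]
    · rw [hΨa, hfAa i (fun h => by subst h; simp [i₀] at hi)]
    · rw [hΨb, hfAb]
    · exact hcuspA j
    · rw [hΨb, hfAb]
    · exact hδA
  have hkillA : ∀ x ∈ Subgroup.closure {x : PuncturedSurfaceGroup g (r' + 1) |
        (∃ i : Fin g, (i : ℕ) < m ∧ (x = PuncturedSurfaceGroup.a i ∨ x = PuncturedSurfaceGroup.b i)) ∨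
        (∃ j : Fin (r' + 1), s ≤ (j : ℕ) ∧ x = PuncturedSurfaceGroup.c j) ∨
        x = PuncturedSurfaceGroup.a ⟨m, hmg⟩ * PuncturedSurfaceGroup.b ⟨m, hmg⟩ *
          (PuncturedSurfaceGroup.a ⟨m, hmg⟩)⁻¹ ∨ x = δ}, b₀.lift fB x = 1 := by
    intro x hx
    rw [← MonoidHom.mem_ker]
    refine (Subgroup.closure_le _).mpr ?_ hx
    rintro y (⟨i, hi, rfl | rfl⟩ | ⟨j, -, rfl⟩ | rfl | rfl) <;> rw [SetLike.mem_coe, MonoidHom.mem_ker]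
    · rw [hΨa, hfBa i (fun h => by subst h; simp [i₁] at hi)]
    · rw [hΨb, hfBb]
    · exact hcuspB j
    · rw [map_mul, map_mul, map_inv, hΨa, hΨb, hfBa _ (fun h => by simp [i₁] at h), hfBb]
      simp
    · exact hδB
  -- witnesses surviving the characters
  have ha₀V₀ : ι (PuncturedSurfaceGroup.a i₀) ∈ G.vertGp v₀ := by
    rw [hV₀]
    exact Subgroup.le_topologicalClosure _ (Subgroup.mem_map_of_mem ι
      (Subgroup.subset_closure (Or.inl ⟨i₀, by simp [i₀]; omega, Or.inl rfl⟩)))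
  have ha₁V₁ : ι (PuncturedSurfaceGroup.a i₁) ∈ G.vertGp v₁ := by
    rw [hV₁]
    exact Subgroup.le_topologicalClosure _ (Subgroup.mem_map_of_mem ι
      (Subgroup.subset_closure (Or.inl ⟨i₁, by simp [i₁], Or.inl rfl⟩)))
  have hΨA₀ : b₀.lift fA (PuncturedSurfaceGroup.a i₀) ≠ 1 := by rw [hΨa, hfA0]; exact hone
  have hΨB₁ : b₀.lift fB (PuncturedSurfaceGroup.a i₁) ≠ 1 := by rw [hΨa, hfB0]; exact hone
  refine G.verticialSeparatingCoverings_of_sameVertex_of_crossVertex ?_ ?_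
  · intro V hVn hVo v γ₁ γ₂ hne12
    haveI := hVn
    rcases hV v with rfl | rfl
    · exact freeFactor_exists_open_separating_sameVertex hι bA S_A hSA_ne hℓ hℓS _ hV₀' V hVo γ₁ γ₂ hne12
    · exact freeFactor_exists_open_separating_sameVertex hι bl S_B hSB_ne hℓ hℓS _ hV₁' V hVo γ₁ γ₂ hne12
  · intro V hVn hVo w₁ w₂ γ₁ γ₂ hw
    haveI := hVn
    rcases hV w₁ with rfl | rfl <;> rcases hV w₂ with rfl | rfl
    · exact absurd rfl hw
    · exact exists_open_separating_of_character hι hℓ hℓS (b₀.lift fA) _ _ hV₁ hkillB _ _ ha₀V₀ hΨA₀ V hVo γ₁ γ₂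
    · exact exists_open_separating_of_character hι hℓ hℓS (b₀.lift fB) _ _ hV₀ hkillA _ _ ha₁V₁ hΨB₁ V hVo γ₁ γ₂
    · exact absurd rfl hw

/-- **F-2826 with its P12-L02/L03 consequences at every two-component datum with TWO nodes**: the
verticial separating coverings, Prop. 1.2 (i) verticial case and Prop. 1.2 (ii) for VERTICIAL subgroups
(w5-d183's reductions). [cite: MochizukiCombGC2007, Prop 1.2(ii) p.8] -/
theorem verticialRows_of_twoNodeCycle (hne : Sigma.Nonempty)
    (hprime : ∀ p ∈ Sigma, p.Prime) (ι : PuncturedSurfaceGroup g r →* P)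
    (hι : IsProSigmaCompletion Sigma ι) (G : PSCDatum P) {m s : ℕ} (hm : m + 2 ≤ g) (hm1 : 1 ≤ m)
    (hs1 : 1 ≤ s) (hsr : s + 1 ≤ r)
    (v₀ v₁ : G.graph.V) (hV : ∀ w, w = v₀ ∨ w = v₁) (δ : PuncturedSurfaceGroup g r)
    (hδ : δ = (((List.finRange r).map fun j : Fin r =>
        if (j : ℕ) < s then PuncturedSurfaceGroup.c (g := g) j else 1).prod)⁻¹ *
      (((List.finRange g).map fun i : Fin g => if m + 1 ≤ (i : ℕ) then
        PuncturedSurfaceGroup.a (r := r) i * PuncturedSurfaceGroup.b i *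
          (PuncturedSurfaceGroup.a i)⁻¹ * (PuncturedSurfaceGroup.b i)⁻¹ else 1).prod)⁻¹ *
      PuncturedSurfaceGroup.b ⟨m, by omega⟩)
    (hV₀ : G.vertGp v₀ = ((Subgroup.closure {x : PuncturedSurfaceGroup g r |
        (∃ i : Fin g, (i : ℕ) < m ∧ (x = PuncturedSurfaceGroup.a i ∨ x = PuncturedSurfaceGroup.b i)) ∨
        (∃ j : Fin r, s ≤ (j : ℕ) ∧ x = PuncturedSurfaceGroup.c j) ∨
        x = PuncturedSurfaceGroup.a ⟨m, by omega⟩ * PuncturedSurfaceGroup.b ⟨m, by omega⟩ *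
          (PuncturedSurfaceGroup.a ⟨m, by omega⟩)⁻¹ ∨ x = δ}).map ι).topologicalClosure)
    (hV₁ : G.vertGp v₁ = ((Subgroup.closure {x : PuncturedSurfaceGroup g r |
        (∃ i : Fin g, m < (i : ℕ) ∧ (x = PuncturedSurfaceGroup.a i ∨ x = PuncturedSurfaceGroup.b i)) ∨
        (∃ j : Fin r, (j : ℕ) < s ∧ x = PuncturedSurfaceGroup.c j) ∨
        x = PuncturedSurfaceGroup.b ⟨m, by omega⟩ ∨ x = δ}).map ι).topologicalClosure) :
    G.VerticialSeparatingCoverings ∧ G.VerticialOpenInterDeterminesVertex ∧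
      ∀ A : Subgroup P, G.IsVerticial A → Subgroup.Commensurable.commensurator A = A := by
  have hsep := G.verticialSeparatingCoverings_of_twoNodeCycle hne hprime ι hι hm hm1 hs1 hsr v₀ v₁ hV δ hδ hV₀ hV₁
  refine ⟨hsep, G.verticialOpenInterDeterminesVertex_of_separating hsep, ?_⟩
  rintro A ⟨v, γ, rfl⟩
  exact G.commensurator_vertGp_eq_of_separating hsep v γ

end Datum

end PSCDatum

end Literature.AnabelianGeometry.SemiGraphs

end
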